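import Summits.Ventures.Crystal3D.Theorems.StickyWulffConstantPolycrystalWulffBoundBoxCert

/-!
# `PolycrystalWulffBound`, line `PolyDensity`: the box certificate in THREE coordinates

Route `StickyWulffConstant` of the venture `Summits/Ventures/Crystal3D`, crux `PolycrystalWulffBound`
(item `stmt-Ventures-19482`), second prover lane (poly-p2, gen 4).  The aggregated all-`m` certificate
(memo `poly-p2/MIDDLE-BAND-g4.md` §12) locates the three largest class fractions `(v₁,v₂,v₃)/V` in a box of
`ℝ³`; as in `box_certificate` (two coordinates), a conic combination of atoms `y_r κ_r (p_r V + q_r v₁ + s_r v₂ +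
u_r v₃)^{2/3}` is jointly concave, so its minimum over the box is attained at one of the EIGHT corners.

* `corner_certificate` — the abstract form over any finite corner set (weights `w`, Jensen for `x^{2/3}`);
* `trilinear_weights` — a point of a box in `ℝ³` is a convex combination of its corners;
* `box_certificate3` — the generator-facing statement with the corners enumerated `Fin 8` in binary order
  (`a/b` for coordinate 1 slowest, then 2, then 3; the corner coordinate vectors are written as `![…]`).
WHAT THIS IS NOT: the certificate (kit job `aggbox`, next gen); F-C1 not moved.
-/

noncomputable section

namespace Summit.Ventures.Crystal3D.Theorems

open Real Finset

/-- **Corner certificate.**  `L r i ≥ 0` is atom `r`'s normalised affine form at corner `i`, `ℓ r` its form at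
the point, `Σ_i w_i L r i · V = ℓ r` with convex weights `w`; if `m ≤ Σ_r y_r κ_r (L r i)^{2/3}` at every corner
then `m·V^{2/3} ≤ Σ_r y_r κ_r (ℓ r)^{2/3}`. -/
theorem corner_certificate {R : ℕ} {ι : Type*} [Fintype ι] (y κ : Fin R → ℝ) (hy : ∀ r, 0 ≤ y r)
    (hκ : ∀ r, 0 ≤ κ r) (L : Fin R → ι → ℝ) (hL : ∀ r i, 0 ≤ L r i) (w : ι → ℝ) (hw : ∀ i, 0 ≤ w i)
    (hw1 : ∑ i, w i = 1) {V m : ℝ} (hV : 0 < V) (ℓ : Fin R → ℝ) (hinterp : ∀ r, (∑ i, w i * L r i) * V = ℓ r)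
    (hc : ∀ i, m ≤ ∑ r, y r * κ r * (L r i) ^ ((2 : ℝ) / 3)) :
    m * V ^ ((2 : ℝ) / 3) ≤ ∑ r, y r * κ r * (ℓ r) ^ ((2 : ℝ) / 3) := by
  have hconc := Real.concaveOn_rpow (p := (2 : ℝ) / 3) (by norm_num) (by norm_num)
  have hV0 : 0 ≤ V := hV.le
  -- Jensen, atom by atom
  have hatom : ∀ r, (∑ i, w i * (L r i) ^ ((2 : ℝ) / 3)) * V ^ ((2 : ℝ) / 3) ≤ (ℓ r) ^ ((2 : ℝ) / 3) := by
    intro r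
    have hJ := hconc.le_map_sum (t := univ) (w := w) (p := L r) (fun i _ => hw i) hw1
      (fun i _ => Set.mem_Ici.2 (hL r i))
    simp only [smul_eq_mul] at hJ
    have hnn : 0 ≤ ∑ i, w i * L r i := sum_nonneg fun i _ => mul_nonneg (hw i) (hL r i)
    rw [← hinterp r, Real.mul_rpow hnn hV0]
    exact mul_le_mul_of_nonneg_right hJ (by positivity)
  -- weight by `y r * κ r` and sum over atoms
  have hsum : (∑ r, y r * κ r * ((∑ i, w i * (L r i) ^ ((2 : ℝ) / 3)) * V ^ ((2 : ℝ) / 3))) ≤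
      ∑ r, y r * κ r * (ℓ r) ^ ((2 : ℝ) / 3) :=
    sum_le_sum fun r _ => mul_le_mul_of_nonneg_left (hatom r) (mul_nonneg (hy r) (hκ r))
  -- regroup by corners
  have hregroup : (∑ r, y r * κ r * ((∑ i, w i * (L r i) ^ ((2 : ℝ) / 3)) * V ^ ((2 : ℝ) / 3))) =
      (∑ i, w i * ∑ r, y r * κ r * (L r i) ^ ((2 : ℝ) / 3)) * V ^ ((2 : ℝ) / 3) := by
    rw [sum_mul]
    have h1 : ∀ r, y r * κ r * ((∑ i, w i * (L r i) ^ ((2 : ℝ) / 3)) * V ^ ((2 : ℝ) / 3)) =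
        ∑ i, (y r * κ r * (w i * (L r i) ^ ((2 : ℝ) / 3))) * V ^ ((2 : ℝ) / 3) := by
      intro r; rw [sum_mul, mul_sum]; exact sum_congr rfl fun i _ => by ring
    have h2 : ∀ i, (w i * ∑ r, y r * κ r * (L r i) ^ ((2 : ℝ) / 3)) * V ^ ((2 : ℝ) / 3) =
        ∑ r, (y r * κ r * (w i * (L r i) ^ ((2 : ℝ) / 3))) * V ^ ((2 : ℝ) / 3) := by
      intro i; rw [mul_sum, sum_mul]; exact sum_congr rfl fun r _ => by ring
    simp only [h1, h2]
    exact sum_comm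
  rw [hregroup] at hsum
  have hcorner : m ≤ ∑ i, w i * ∑ r, y r * κ r * (L r i) ^ ((2 : ℝ) / 3) := by
    calc m = ∑ i, w i * m := by rw [← sum_mul, hw1, one_mul]
      _ ≤ _ := sum_le_sum fun i _ => mul_le_mul_of_nonneg_left (hc i) (hw i)
  exact le_trans (mul_le_mul_of_nonneg_right hcorner (by positivity)) hsum

/-- **Trilinear weights**: a point `(s,t,r)` of the box `[a₁,b₁]×[a₂,b₂]×[a₃,b₃]` is a convex combination of
the eight corners. -/
theorem trilinear_weights {a₁ b₁ a₂ b₂ a₃ b₃ s t r : ℝ} (hab₁ : a₁ < b₁) (hab₂ : a₂ < b₂) (hab₃ : a₃ < b₃)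
    (hs₁ : a₁ ≤ s) (hs₂ : s ≤ b₁) (ht₁ : a₂ ≤ t) (ht₂ : t ≤ b₂) (hr₁ : a₃ ≤ r) (hr₂ : r ≤ b₃) :
    ∃ w : Fin 8 → ℝ, (∀ i, 0 ≤ w i) ∧ ∑ i, w i = 1 ∧ ∑ i, w i * (![a₁, a₁, a₁, a₁, b₁, b₁, b₁, b₁] : Fin 8 → ℝ) i = s ∧
      ∑ i, w i * (![a₂, a₂, b₂, b₂, a₂, a₂, b₂, b₂] : Fin 8 → ℝ) i = t ∧ ∑ i, w i * (![a₃, b₃, a₃, b₃, a₃, b₃, a₃, b₃] : Fin 8 → ℝ) i = r := by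
  have hd₁ : 0 < b₁ - a₁ := sub_pos.2 hab₁
  have hd₂ : 0 < b₂ - a₂ := sub_pos.2 hab₂
  have hd₃ : 0 < b₃ - a₃ := sub_pos.2 hab₃
  -- one-dimensional weights
  set l₁ := (b₁ - s) / (b₁ - a₁) with hl₁
  set u₁ := (s - a₁) / (b₁ - a₁) with hu₁
  set l₂ := (b₂ - t) / (b₂ - a₂) with hl₂
  set u₂ := (t - a₂) / (b₂ - a₂) with hu₂
  set l₃ := (b₃ - r) / (b₃ - a₃) with hl₃
  set u₃ := (r - a₃) / (b₃ - a₃) with hu₃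
  have hl₁0 : 0 ≤ l₁ := div_nonneg (by linarith) hd₁.le
  have hu₁0 : 0 ≤ u₁ := div_nonneg (by linarith) hd₁.le
  have hl₂0 : 0 ≤ l₂ := div_nonneg (by linarith) hd₂.le
  have hu₂0 : 0 ≤ u₂ := div_nonneg (by linarith) hd₂.le
  have hl₃0 : 0 ≤ l₃ := div_nonneg (by linarith) hd₃.le
  have hu₃0 : 0 ≤ u₃ := div_nonneg (by linarith) hd₃.le
  have hs1 : l₁ + u₁ = 1 := by rw [hl₁, hu₁, ← add_div]; field_simp; ring
  have hs2 : l₂ + u₂ = 1 := by rw [hl₂, hu₂, ← add_div]; field_simp; ring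
  have hs3 : l₃ + u₃ = 1 := by rw [hl₃, hu₃, ← add_div]; field_simp; ring
  have hm1 : l₁ * a₁ + u₁ * b₁ = s := by rw [hl₁, hu₁]; field_simp; ring
  have hm2 : l₂ * a₂ + u₂ * b₂ = t := by rw [hl₂, hu₂]; field_simp; ring
  have hm3 : l₃ * a₃ + u₃ * b₃ = r := by rw [hl₃, hu₃]; field_simp; ring
  refine ⟨![l₁ * l₂ * l₃, l₁ * l₂ * u₃, l₁ * u₂ * l₃, l₁ * u₂ * u₃, u₁ * l₂ * l₃, u₁ * l₂ * u₃, u₁ * u₂ * l₃,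
    u₁ * u₂ * u₃], ?_, ?_, ?_, ?_, ?_⟩
  · intro i; fin_cases i <;> simp <;> positivity
  · simp only [Fin.sum_univ_eight, Matrix.cons_val]
    linear_combination (l₂ * l₃ + l₂ * u₃ + u₂ * l₃ + u₂ * u₃) * hs1 + (l₃ + u₃) * hs2 + hs3
  · simp only [Fin.sum_univ_eight, Matrix.cons_val]
    linear_combination (l₂ * l₃ + l₂ * u₃ + u₂ * l₃ + u₂ * u₃) * hm1 + s * (l₃ + u₃) * hs2 + s * hs3
  · simp only [Fin.sum_univ_eight, Matrix.cons_val]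
    linear_combination (l₁ * l₃ + l₁ * u₃ + u₁ * l₃ + u₁ * u₃) * hm2 + t * (l₃ + u₃) * hs1 + t * hs3
  · simp only [Fin.sum_univ_eight, Matrix.cons_val]
    linear_combination (l₁ * l₂ + l₁ * u₂ + u₁ * l₂ + u₁ * u₂) * hm3 + r * (l₂ + u₂) * hs1 + r * hs2

/-- **Box certificate in three coordinates.**  Atoms `y_r κ_r (p_r V + q_r v₁ + s_r v₂ + u_r v₃)^{2/3}`
(`y, κ ≥ 0`), a box `a_k V ≤ v_k ≤ b_k V`, the affine forms non-negative at the eight corners and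
`m ≤ Σ_r y_r κ_r (form at corner i)^{2/3}` for every corner `i : Fin 8` (corner coordinates `![a,a,a,a,b,b,b,b]`, `![a,a,b,b,a,a,b,b]`, `![a,b,a,b,a,b,a,b]`) give
`m·V^{2/3} ≤ Σ_r y_r κ_r (p_r V + q_r v₁ + s_r v₂ + u_r v₃)^{2/3}`. -/
theorem box_certificate3 {R : ℕ} (y κ p q s u : Fin R → ℝ) (hy : ∀ r, 0 ≤ y r) (hκ : ∀ r, 0 ≤ κ r)
    {V a₁ b₁ a₂ b₂ a₃ b₃ v₁ v₂ v₃ m : ℝ} (hV : 0 < V) (hab₁ : a₁ < b₁) (hab₂ : a₂ < b₂) (hab₃ : a₃ < b₃)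
    (h₁ : a₁ * V ≤ v₁) (h₁' : v₁ ≤ b₁ * V) (h₂ : a₂ * V ≤ v₂) (h₂' : v₂ ≤ b₂ * V) (h₃ : a₃ * V ≤ v₃)
    (h₃' : v₃ ≤ b₃ * V)
    (hnn : ∀ i r, 0 ≤ p r + q r * (![a₁, a₁, a₁, a₁, b₁, b₁, b₁, b₁] : Fin 8 → ℝ) i + s r * (![a₂, a₂, b₂, b₂, a₂, a₂, b₂, b₂] : Fin 8 → ℝ) i + u r * (![a₃, b₃, a₃, b₃, a₃, b₃, a₃, b₃] : Fin 8 → ℝ) i)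
    (hc : ∀ i, m ≤ ∑ r, y r * κ r *
      (p r + q r * (![a₁, a₁, a₁, a₁, b₁, b₁, b₁, b₁] : Fin 8 → ℝ) i + s r * (![a₂, a₂, b₂, b₂, a₂, a₂, b₂, b₂] : Fin 8 → ℝ) i + u r * (![a₃, b₃, a₃, b₃, a₃, b₃, a₃, b₃] : Fin 8 → ℝ) i) ^ ((2 : ℝ) / 3)) :
    m * V ^ ((2 : ℝ) / 3) ≤ ∑ r, y r * κ r * (p r * V + q r * v₁ + s r * v₂ + u r * v₃) ^ ((2 : ℝ) / 3) := by
  have hVne : V ≠ 0 := hV.ne'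
  obtain ⟨w, hw, hw1, hws, hwt, hwr⟩ := trilinear_weights (s := v₁ / V) (t := v₂ / V) (r := v₃ / V) hab₁ hab₂ hab₃
    (by rw [le_div_iff₀ hV]; exact h₁) (by rw [div_le_iff₀ hV]; exact h₁')
    (by rw [le_div_iff₀ hV]; exact h₂) (by rw [div_le_iff₀ hV]; exact h₂')
    (by rw [le_div_iff₀ hV]; exact h₃) (by rw [div_le_iff₀ hV]; exact h₃')
  refine corner_certificate y κ hy hκ
    (fun r i => p r + q r * (![a₁, a₁, a₁, a₁, b₁, b₁, b₁, b₁] : Fin 8 → ℝ) i + s r * (![a₂, a₂, b₂, b₂, a₂, a₂, b₂, b₂] : Fin 8 → ℝ) i + u r * (![a₃, b₃, a₃, b₃, a₃, b₃, a₃, b₃] : Fin 8 → ℝ) i)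
    (fun r i => hnn i r) w hw hw1 hV (fun r => p r * V + q r * v₁ + s r * v₂ + u r * v₃) ?_ hc
  intro r
  have hexp : (∑ i, w i * (p r + q r * (![a₁, a₁, a₁, a₁, b₁, b₁, b₁, b₁] : Fin 8 → ℝ) i + s r * (![a₂, a₂, b₂, b₂, a₂, a₂, b₂, b₂] : Fin 8 → ℝ) i + u r * (![a₃, b₃, a₃, b₃, a₃, b₃, a₃, b₃] : Fin 8 → ℝ) i)) =
      p r * (∑ i, w i) + q r * (∑ i, w i * (![a₁, a₁, a₁, a₁, b₁, b₁, b₁, b₁] : Fin 8 → ℝ) i) + s r * (∑ i, w i * (![a₂, a₂, b₂, b₂, a₂, a₂, b₂, b₂] : Fin 8 → ℝ) i) +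
        u r * (∑ i, w i * (![a₃, b₃, a₃, b₃, a₃, b₃, a₃, b₃] : Fin 8 → ℝ) i) := by
    rw [mul_sum, mul_sum, mul_sum, mul_sum, ← sum_add_distrib, ← sum_add_distrib, ← sum_add_distrib]
    exact sum_congr rfl fun i _ => by ring
  rw [hexp, hw1, hws, hwt, hwr]
  field_simp

end Summit.Ventures.Crystal3D.Theorems

end
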